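import Summits.BirchSwinnertonDyer.BirchSwinnertonDyer.Theorems.SmallImageMuTransferMuTransferX9TameClassValueInput
import Summits.BirchSwinnertonDyer.BirchSwinnertonDyer.Theorems.ByReductionTypeAtTwoOrdKatoHalfAtTwoIsoTameClassTwo
import Summits.BirchSwinnertonDyer.BirchSwinnertonDyer.Theorems.ByReductionTypeAtTwoOrdKatoHalfAtTwoIsoFrobeniusAtTwoAux
import HarnessLib

/-!
# Route ByReductionTypeAtTwo, crux `OrdKatoHalfAtTwoIso` (stmt-BirchSwinnertonDyer-19573), line `steinberg-fibre-at-two`,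
# registered stub `stub_HK_kolyvaginRankOneTwo` (Ω2 = H-K), interior step (C) = K1: the VALUE INPUT at `p = 2` —
# the genuine tame cocycle at level `L = 2^{d+2}` (H16 at `2`) with its norm relation in OPERATOR form
# `ψ'(g) = (φ̃ − 1)((φ̃ − 1)(φ(g)))`, `φ̃ = (1+S)^{2ᵈu}`, and the action of EVERY local Frobenius at `q` on
# `𝒯_L` as `φ̃ ∘ (slotwise action)` — for a TRANSPOSITION Frobenius of exact depth `d`

Seat `cruxlead-stmt-BirchSwinnertonDyer-19573-g0` (LEAD PROVER, MODE LINE; HOME `run/shared/lean/pub/bsd-2adic/`).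
THEOREMS ONLY. HONEST FRAMING (cell bsd-2adic): BSD is not proved by any of this; the crux is not proved;
`--supports` helper toward the lead's registered research stub `stub_HK_kolyvaginRankOneTwo : KolyvaginRankOneTwo`
(skeleton v5), closing nothing. The `p = 2` twin of `TameClass.exists_tameCocycle_valueInput`
(`Theorems/SmallImageMuTransferMuTransferX9TameClassValueInput.lean`, koly/k6-g3), fed by the landed `p = 2` tame class
`TameClass.exists_tameClass_of_isEulerSystemClassTwo` (W3c, p660933) and the lead's Euler factor modulo `2` at a
Frobenius of square `1` on `E[2]` (`map_toZMod_rubinEulerFactor_two`, file `…FrobeniusAtTwoAux.lean`, p661875). Differences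
from the odd twin: the level is `2^{d+2}` (so that `J + 2^{d+1} ≤ L` for `J ≤ 2ᵈ`, the K3 division margin — at odd `p`
the level `p^{n+1}` with `J = 2pⁿ` needs `p ≥ 3`), the Frobenius is a transposition (`ρ̄₂(Fr)² = 1`) instead of
`E`-split, and (act) records the action of a local Frobenius `r` as `φ̃ ∘ (r slotwise)` instead of `φ̃`.

References: K. Kato, Astérisque 295 (2004) (8.1.3), §13.1 (13.1.1), Ex. 13.3 [Kato2004Asterisque]; K. Rubin,
*Euler Systems* (2000) Lemma 4.4.2 [Rubin2000]; L. Washington, *Introduction to Cyclotomic Fields* (1997) §13.1–13.2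
[Washington1997]; B. Mazur, K. Rubin, Mem. AMS 799 (2004) §1.2 [MazurRubin2004].
-/

set_option linter.dupNamespace false
set_option autoImplicit false

noncomputable section

open CategoryTheory Function Finset Polynomial
open scoped NumberField Pointwise ContRepresentation
open Field IsDedekindDomain
open Literature.NumberTheory.GaloisRepresentations
open Literature.NumberTheory.GaloisRepresentations.IsNonarchimedeanLocalField
open Literature.NumberTheory.EllipticCurves
open Literature.NumberTheory.EllipticCurves.ZpExtension
open Literature.NumberTheory.EllipticCurves.Kato2004
open Literature.NumberTheory.EllipticCurves.Kato2004.EulerSystemValues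
open Rat.HeightOneSpectrum
open Summit.BirchSwinnertonDyer.Rank1Residual.GaloisImage
open Summit.BirchSwinnertonDyer.BirchSwinnertonDyer.Rank1Residual
open Summit.BirchSwinnertonDyer.BirchSwinnertonDyer.Rank1Residual.TameClass

namespace Summit.BirchSwinnertonDyer.BirchSwinnertonDyer.Theorems.SteinbergFibreAtTwo

variable (W : WeierstrassCurve ℚ) [W.IsElliptic] [W.IsGloballyMinimal]
  [ContinuousSMul ℤ_[2] (W.tateModule 2)]
  [Module.Free ℤ_[2] (W.tateModule 2)] [Module.Finite ℤ_[2] (W.tateModule 2)]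
  (κ : ZpExtension ℚ 2) (hκ : κ.IsCyclotomic) (γ : absoluteGaloisGroup ℚ) (I : IwasawaH1Data W 2 κ γ)

/-- **The VALUE INPUT of the Kolyvagin cocycle at `p = 2`, at a TRANSPOSITION Frobenius of exact depth `d`**
(K1 of the Ω road; operator form at every local Frobenius). For a genuine `2`-adic Λ-adic Euler-system class `s`
(`IsEulerSystemClassTwo`) there is a finite `S₀` such that for every `q ∉ S₀` (prime `ℓ`), `𝔓 ∣ q`, arithmetic
Frobenius `Fr` at `𝔓` with `ρ̄_{E,2}(Fr)² = 1` and `Fr ∈ Γ^{2ᵈ} ∖ Γ^{2^{d+1}}`: `q ∤ 2`, `E[2]` is unramified at `q`,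
`2 ∣ ℓ − 1`, and there are `u` odd and a cocycle `y'` on `N = Gal(ℚ̄/ℚ(μ_ℓ))` with values in `𝒯_L`, `L = 2^{d+2}`,
such that: (act) EVERY local arithmetic Frobenius `r` of `ℚ_q` acts on `𝒯_L` by `φ̃ ∘ (r slotwise)`,
`φ̃ := (1+S)^{2ᵈu}`; (I1) `y'` is integral; and for every cocycle `φ` of `𝐳̄₁ = (I.redTower s)_L` there is a
cocycle `ψ'` with VALUES `ψ'(g) = (φ̃ − 1)((φ̃ − 1)(φ(g)))`, the norm relation `cor_N [y'] = [ψ']`, and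
`ψ'(g) mod T^J = 0` for all `J ≤ 2^{d+1}`. The `p = 2` twin of `TameClass.exists_tameCocycle_valueInput`.
[cite: Kato2004Asterisque, (8.1.3), §13.1 (13.1.1) and Ex. 13.3] [cite: Rubin2000, Lemma 4.4.2]
[cite: Washington1997, §13.1–§13.2 and Prop. 13.2] -/
theorem exists_tameCocycle_valueInput_two {s : I.H} (hES : IsEulerSystemClassTwo W hκ I s) :
    ∃ S₀ : Set (HeightOneSpectrum (𝓞 ℚ)), S₀.Finite ∧
      ∀ (q : HeightOneSpectrum (𝓞 ℚ)), q ∉ S₀ →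
      ∀ {𝔓 : Ideal (absIntegers (𝓞 ℚ) ℚ)}, 𝔓 ∈ q.primesAbove →
      ∀ {Fr : absoluteGaloisGroup ℚ}, IsArithFrobAt (𝓞 ℚ) Fr 𝔓 →
        WeierstrassCurve.galoisRepTorsion W 2 (Fr * Fr) = 1 →
      ∀ {d : ℕ}, Fr ∈ κ.layerSubgroup d → Fr ∉ κ.layerSubgroup (d + 1) →
      ∀ [NeZero ((primesEquiv q : Nat.Primes) : ℕ)]
        [Fintype (absoluteGaloisGroup ℚ ⧸ rootsOfUnityFixer ℚ ((primesEquiv q : Nat.Primes) : ℕ))],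
      (2 : 𝓞 ℚ) ∉ q.asIdeal ∧ GaloisRep.IsUnramifiedAt q (W.torsionGaloisModule (2 : ℤ)) ∧
      2 ∣ ((primesEquiv q : Nat.Primes) : ℕ) - 1 ∧
      ∃ (u : ℕ) (y' : contOneCocycles (subgroupRep (κ.twistModP (W.torsionGaloisModule (2 : ℤ))
            IwasawaH1Data.torsion_nsmul_eq_zero (2 ^ (d + 2))).toTopRep
            (rootsOfUnityFixer ℚ ((primesEquiv q : Nat.Primes) : ℕ)))),
        ¬ 2 ∣ u ∧
        -- (act) every local Frobenius at `q` acts on `𝒯_{2^{d+2}}` by `(1+S)^{2ᵈu}` after its slotwise action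
        (∀ r : absoluteGaloisGroup (q.adicCompletion ℚ), IsAbsArithFrob r →
          ∀ x : Fin (2 ^ (d + 2)) → WeierstrassCurve.geomTorsion W (2 : ℤ),
            κ.twistModP (W.torsionGaloisModule (2 : ℤ)) IwasawaH1Data.torsion_nsmul_eq_zero (2 ^ (d + 2))
              (absGaloisRestrict ℚ (q.adicCompletion ℚ) r) x =
            unipotentPow (WeierstrassCurve.geomTorsion W (2 : ℤ)) (2 ^ (d + 2)) (2 ^ d * u)
              (fun i => W.torsionGaloisModule (2 : ℤ) (absGaloisRestrict ℚ (q.adicCompletion ℚ) r) (x i))) ∧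
        -- (I1) integrality of `y'`
        (∀ w : HeightOneSpectrum (𝓞 ℚ), (2 : 𝓞 ℚ) ∉ w.asIdeal → ∀ 𝔓' ∈ w.primesAbove,
          resLe (κ.twistModP (W.torsionGaloisModule (2 : ℤ)) IwasawaH1Data.torsion_nsmul_eq_zero
              (2 ^ (d + 2))).toTopRep
            (inf_le_left : rootsOfUnityFixer ℚ ((primesEquiv q : Nat.Primes) : ℕ) ⊓
              𝔓'.inertia (absoluteGaloisGroup ℚ) ≤ _) 1 (oneCocycleClass _ y') = 0) ∧
        -- the norm relation in operator form, with `hψJ`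
        ∀ φ : contOneCocycles (κ.twistModP (W.torsionGaloisModule (2 : ℤ))
            IwasawaH1Data.torsion_nsmul_eq_zero (2 ^ (d + 2))).toTopRep,
          oneCocycleClass _ φ = (I.redTower s : ∀ J : ℕ, galoisCohomology (κ.twistModP
            (W.torsionGaloisModule (2 : ℤ)) IwasawaH1Data.torsion_nsmul_eq_zero J) 1) (2 ^ (d + 2)) →
          ∃ ψ' : contOneCocycles (κ.twistModP (W.torsionGaloisModule (2 : ℤ))
              IwasawaH1Data.torsion_nsmul_eq_zero (2 ^ (d + 2))).toTopRep,
            (∀ g, ψ'.1 g =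
              (unipotentPow (WeierstrassCurve.geomTorsion W (2 : ℤ)) (2 ^ (d + 2)) (2 ^ d * u) - 1)
                ((unipotentPow (WeierstrassCurve.geomTorsion W (2 : ℤ)) (2 ^ (d + 2)) (2 ^ d * u) - 1)
                  (φ.1 g))) ∧
            cores (κ.twistModP (W.torsionGaloisModule (2 : ℤ)) IwasawaH1Data.torsion_nsmul_eq_zero
                (2 ^ (d + 2))).toTopRep (rootsOfUnityFixer ℚ ((primesEquiv q : Nat.Primes) : ℕ))
              (isOpen_rootsOfUnityFixer ℚ _) (oneCocycleClass _ y') = oneCocycleClass _ ψ' ∧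
            ∀ {J : ℕ} (hJL : J ≤ 2 ^ (d + 2)), J ≤ 2 * 2 ^ d →
              ∀ (g : absoluteGaloisGroup ℚ) (i : Fin J), ψ'.1 g (Fin.castLE hJL i) = 0 := by
  classical
  haveI : Fact (2 : ℕ).Prime := ⟨Nat.prime_two⟩
  obtain ⟨S₀, hS₀, hmain⟩ := exists_tameClass_of_isEulerSystemClassTwo W κ hκ γ I hES
  obtain ⟨S₁, hS₁, hsub, hgood⟩ :=
    TorsionUnramified.exists_finite_superset_isUnramifiedAt_torsionGaloisModule W (K := ℚ)
      (p := 2) two_ne_zero hS₀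
  refine ⟨S₁, hS₁, ?_⟩
  intro q hq1 𝔓 h𝔓 Fr hFr hT d hFrd hFrd' _ _
  have hq0 : q ∉ S₀ := fun h ↦ hq1 (hsub h)
  obtain ⟨hqp, hqgood, hunr⟩ := hgood q hq1
  have hne : ((primesEquiv q : Nat.Primes) : ℕ) ≠ 2 := primesEquiv_ne_of_natCast_not_mem hqp
  have hFr' : IsArithFrobAtPlace ℚ q Fr := ⟨𝔓, h𝔓, hFr⟩
  -- `2 ∣ ℓ - 1` (`ℓ` is an odd prime)
  have hdvd : 2 ∣ ((primesEquiv q : Nat.Primes) : ℕ) - 1 := by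
    obtain ⟨k, hk⟩ := ((primesEquiv q).2.eq_two_or_odd').resolve_left hne
    exact ⟨k, by omega⟩
  -- the Euler factor `(1 − X)²` modulo `2` and the exponent `2ᵈ·u`
  have hPz : ((1 - X) ^ 2 : ℤ[X]).map (Int.castRingHom (ZMod 2)) =
      (rubinEulerFactor (tateRep W 2).toRepresentation (cyclotomicCharacterToUnits ℚ 2 ℤ_[2]) Fr).map
        (PadicInt.toZMod (p := 2)) :=
    (map_toZMod_rubinEulerFactor_two W hne hqgood h𝔓 hFr hT).symm
  obtain ⟨u, hu, ha⟩ := LocalSplitPrime.twistExponent_eq_prime_pow_mul_of_depth κ (J := d + 2)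
    (by omega) hFrd hFrd'
  have ha' : ((2 ^ d * u : ℕ) : ZMod (2 ^ (d + 2))) = κ.layerIndex (d + 2) Fr := by
    rw [← ha]
    exact κ.natCast_twistExponent (d + 2) (d + 2) le_rfl Fr
  obtain ⟨y, hyint, hynorm⟩ := hmain q hq0 (d + 2) Fr hFr' ((1 - X) ^ 2) hPz (2 ^ d * u) ha'
    (isOpen_rootsOfUnityFixer ℚ _)
  obtain ⟨y', rfl⟩ := oneCocycleClass_surjective _ y
  refine ⟨hqp, hunr, hdvd, u, y', hu, fun r hr x ↦ ?_, fun w hw 𝔓' h𝔓' ↦ ?_, fun φ hφ ↦ ?_⟩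
  · -- (act): `κ(res r) = κ(Fr)`, so the exponent of `res r` at level `2^{d+2}` is `2ᵈu`
    have hexp : ((κ.twistExponent (2 ^ (d + 2)) (absGaloisRestrict ℚ (q.adicCompletion ℚ) r) : ℕ) :
        ZMod (2 ^ (d + 2))) = ((2 ^ d * u : ℕ) : ZMod (2 ^ (d + 2))) := by
      rw [κ.natCast_twistExponent (d + 2) (2 ^ (d + 2))
        (Nat.lt_pow_self (Fact.out : (2 : ℕ).Prime).one_lt).le, ha']
      unfold ZpExtension.layerIndex
      rw [apply_absGaloisRestrict_eq_of_isArithFrobAt κ hqp h𝔓 hFr hr]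
    rw [twistModP_apply]
    exact LinearMap.congr_fun
      (unipotentPow_eq_of_natCast_eq (n := d + 2) IwasawaH1Data.torsion_nsmul_eq_zero hexp) _
  · exact (mem_integralH1_iff _ 2 _ _).1 hyint w (primesEquiv_ne_of_natCast_not_mem hw) 𝔓' h𝔓'
  · obtain ⟨ψ, hψ, hclass⟩ := hynorm φ hφ
    refine ⟨ψ, fun g ↦ ?_, hclass, fun hJL hJ2 g i ↦ ?_⟩
    · rw [hψ g, aeval_one_sub_X_sq_apply]
    · rw [hψ g, aeval_one_sub_X_sq_apply]
      exact castLE_unipotentPow_sub_one_sq_apply_eq_zero IwasawaH1Data.torsion_nsmul_eq_zero d u hJL hJ2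
        (φ.1 g) i

end Summit.BirchSwinnertonDyer.BirchSwinnertonDyer.Theorems.SteinbergFibreAtTwo

end
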